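import Summits.CriticalPhenomena.PercolationContinuityZ3.Theorems.PercNearOneGluingNoHeavyLowerTailThresholdTwo
import Summits.CriticalPhenomena.PercolationContinuityZ3.Theorems.PercNearOneGluingNoHeavyLowerTailThreePartitionLift

/-!
# `NoHeavyLowerTail` (crux stmt-CriticalPhenomena-4575), lane prim-ineq-gen-4 (gen 17): **THREE-PARTITION POSITIVITY WITH THE THRESHOLD SLOT
# `Θ₂ = {T : 2 ≤ |T|}` — `0 ≤ threePartN Θ₂ V W` for all up-sets `V, W`, every ground set with at least four points**

Support file (`--supports stmt-CriticalPhenomena-4575`; memo `run/shared/lean/prim/prim-ineq-gen-4/FINDING-THRESHOLD-FIBREWISE-g17.md`, proof text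
`PROOFS-THRESHOLD-TWO-g17.md`).  Pure proofs, no definitions, no `sorry`, standard axioms.

THEOREM (`threePartN_thresholdTwo_nonneg`): for a finite type `ι` with `4 ≤ card ι` and up-sets `V, W ⊆ 𝒫(ι)`,
`0 ≤ ThreePartition.threePartN {T | 2 ≤ T.ncard} V W`.  This is the lane's conjecture `ThreePartitionPositivity` (the three-partition = comb form
of Sahi's `C₃` / Kahn's Conjecture 5) for the first THRESHOLD slot outside the proved strata: `Θ₂` is symmetric, not principal, not a cylinder,
not comparable to or independent of a general `V`, and does not contain `V ∩ W`.  (Ground sets with `≤ 4` points are covered by the tree's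
computational `threePartN_nonneg_of_card_le_four`; `Θ₁ = {T ≠ ∅} ⊇ V ∩ W` is the meet-containing stratum.)

PROOF: the counting-form theorem `ThresholdTwoFibre.thresholdTwo_counting` (the spectator-by-spectator certificate) transported from
finsets to the `Set ι`-valued ordered 3-partitions of `ThreePartition.tri` (`tri_eq_card_finsetPairs`), plus the slot symmetries
`threePartN_swap12/13` (from `tee_swap12/13`) and `threePartN_univ_nonneg` for the degenerate families `V = ⊤` or `W = ⊤`.
-/

noncomputable section

open Finset
open scoped Classical

namespace Summit.CriticalPhenomena.PercolationContinuityZ3.Theorems.ThreePartition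

variable {ι : Type*} [Fintype ι]

/-- `threePartN` is symmetric in its first two slots. [this work] -/
theorem threePartN_swap12 (𝒰 𝒱 𝒲 : Set (Set ι)) : threePartN 𝒰 𝒱 𝒲 = threePartN 𝒱 𝒰 𝒲 := by
  unfold threePartN
  rw [tee_swap12 𝒰 𝒱 𝒲, Set.inter_comm 𝒰 𝒱]
  push_cast
  ring

/-- `threePartN` is symmetric in its first and third slots. [this work] -/
theorem threePartN_swap13 (𝒰 𝒱 𝒲 : Set (Set ι)) : threePartN 𝒰 𝒱 𝒲 = threePartN 𝒲 𝒱 𝒰 := by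
  unfold threePartN
  rw [tee_swap13 𝒰 𝒱 𝒲]
  have h1 : 𝒰 ∩ 𝒱 ∩ 𝒲 = 𝒲 ∩ 𝒱 ∩ 𝒰 := by ext T; simp only [Set.mem_inter_iff]; tauto
  have h2 : 𝒱 ∩ 𝒲 = 𝒲 ∩ 𝒱 := Set.inter_comm _ _
  have h3 : 𝒰 ∩ 𝒱 = 𝒱 ∩ 𝒰 := Set.inter_comm _ _
  have h4 : 𝒰 ∩ 𝒲 = 𝒲 ∩ 𝒰 := Set.inter_comm _ _
  rw [h1, h2, h3, h4]
  push_cast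
  ring

omit [Fintype ι] in
/-- An up-set of sets containing `∅` is everything. [folklore] -/
theorem eq_univ_of_empty_mem {𝒱 : Set (Set ι)} (h𝒱 : IsUpperSet 𝒱) (h : (∅ : Set ι) ∈ 𝒱) : 𝒱 = Set.univ :=
  Set.eq_univ_of_forall fun T => h𝒱 (Set.empty_subset T) h

/-- The threshold family `Θ₂ = {T | 2 ≤ T.ncard}` is an up-set. [folklore] -/
theorem isUpperSet_thresholdTwo : IsUpperSet {T : Set ι | 2 ≤ T.ncard} :=
  fun _ _ hab ha => le_trans ha (Set.ncard_le_ncard hab (Set.toFinite _))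

/-- Transport of the partition count `tri` to pairs of finsets (parts 1 and 2 as finsets, part 3 as the complement of their union). [this work] -/
theorem tri_eq_card_finsetPairs (p : Set ι → Set ι → Set ι → Prop) :
    tri p = #((univ : Finset (Finset ι × Finset ι)).filter fun r =>
      Disjoint r.1 r.2 ∧ p (↑r.1) (↑r.2) ((r.1 : Set ι) ∪ (r.2 : Set ι))ᶜ) := by
  unfold tri
  refine card_bij' (fun q _ => ((Fintype.finsetEquivSet (α := ι)).symm q.1, (Fintype.finsetEquivSet (α := ι)).symm q.2))
    (fun r _ => ((r.1 : Set ι), (r.2 : Set ι))) (fun q hq => ?_) (fun r hr => ?_) (fun q _ => ?_) (fun r _ => ?_)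
  · have e1 : (((Fintype.finsetEquivSet (α := ι)).symm q.1 : Finset ι) : Set ι) = q.1 :=
      (Fintype.finsetEquivSet (α := ι)).apply_symm_apply q.1
    have e2 : (((Fintype.finsetEquivSet (α := ι)).symm q.2 : Finset ι) : Set ι) = q.2 :=
      (Fintype.finsetEquivSet (α := ι)).apply_symm_apply q.2
    simp only [mem_filter, mem_univ, true_and] at hq ⊢
    refine ⟨disjoint_coe.1 ?_, ?_⟩
    · rw [e1, e2]; exact hq.1
    · rw [e1, e2]; exact hq.2
  · simp only [mem_filter, mem_univ, true_and] at hr ⊢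
    exact ⟨disjoint_coe.2 hr.1, hr.2⟩
  · exact Prod.ext ((Fintype.finsetEquivSet (α := ι)).apply_symm_apply q.1)
      ((Fintype.finsetEquivSet (α := ι)).apply_symm_apply q.2)
  · exact Prod.ext ((Fintype.finsetEquivSet (α := ι)).symm_apply_apply r.1)
      ((Fintype.finsetEquivSet (α := ι)).symm_apply_apply r.2)

omit [Fintype ι] in
/-- For disjoint finsets `a, b` of a finite type: `(a ∪ (a ∪ b)ᶜ)ᶜ = b`. [folklore] -/
theorem compl_union_compl_union [Fintype ι] [DecidableEq ι] {a b : Finset ι} (h : Disjoint a b) : (a ∪ (a ∪ b)ᶜ)ᶜ = b := by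
  ext x
  rw [mem_compl, mem_union, mem_compl, mem_union, not_or, not_not]
  constructor
  · rintro ⟨hxa, hab⟩; exact hab.resolve_left hxa
  · intro hxb; exact ⟨fun hxa => disjoint_left.1 h hxa hxb, Or.inr hxb⟩

omit [Fintype ι] in
/-- For disjoint finsets `a, b` of a finite type: `((a ∪ b)ᶜ ∪ a)ᶜ = b`. [folklore] -/
theorem compl_compl_union_union [Fintype ι] [DecidableEq ι] {a b : Finset ι} (h : Disjoint a b) : ((a ∪ b)ᶜ ∪ a)ᶜ = b := by
  rw [union_comm (a ∪ b)ᶜ a]; exact compl_union_compl_union h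

omit [Fintype ι] in
/-- The third part is disjoint from the first. [folklore] -/
theorem disjoint_compl_union_left [Fintype ι] [DecidableEq ι] (a b : Finset ι) : Disjoint (a ∪ b)ᶜ a :=
  disjoint_left.2 fun _ hx hxa => (mem_compl.1 hx) (mem_union_left _ hxa)

omit [Fintype ι] in
/-- Coercion of the third part. [folklore] -/
theorem coe_union_compl [Fintype ι] [DecidableEq ι] (a b : Finset ι) : ((a : Set ι) ∪ (b : Set ι))ᶜ = (((a ∪ b)ᶜ : Finset ι) : Set ι) := by
  rw [coe_compl, coe_union]

omit [Fintype ι] in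
/-- Mixed coercion form of `compl_union_compl_union`. [folklore] -/
theorem coe_union_coe_compl_union [Fintype ι] [DecidableEq ι] {a b : Finset ι} (h : Disjoint a b) :
    ((a : Set ι) ∪ (((a ∪ b)ᶜ : Finset ι) : Set ι))ᶜ = (b : Set ι) := by
  rw [← coe_union, ← coe_compl, compl_union_compl_union h]

omit [Fintype ι] in
/-- Mixed coercion form of `compl_compl_union_union`. [folklore] -/
theorem coe_compl_union_union_coe [Fintype ι] [DecidableEq ι] {a b : Finset ι} (h : Disjoint a b) :
    ((((a ∪ b)ᶜ : Finset ι) : Set ι) ∪ (a : Set ι))ᶜ = (b : Set ι) := by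
  rw [← coe_union, ← coe_compl, compl_compl_union_union h]

/-- **Three-partition positivity with the threshold slot `Θ₂`.**  For a finite type with at least four points and all up-sets `V, W`:
`0 ≤ threePartN {T | 2 ≤ T.ncard} V W`. [this work] -/
theorem threePartN_thresholdTwo_nonneg [DecidableEq ι] (hι : 4 ≤ Fintype.card ι) (V W : Set (Set ι))
    (hV : IsUpperSet V) (hW : IsUpperSet W) :
    0 ≤ threePartN {T : Set ι | 2 ≤ T.ncard} V W := by
  by_cases hV0 : (∅ : Set ι) ∈ V
  · rw [eq_univ_of_empty_mem hV hV0, threePartN_swap12]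
    exact threePartN_univ_nonneg isUpperSet_thresholdTwo hW
  by_cases hW0 : (∅ : Set ι) ∈ W
  · rw [eq_univ_of_empty_mem hW hW0, threePartN_swap13]
    exact threePartN_univ_nonneg hV isUpperSet_thresholdTwo
  set V' : Finset (Finset ι) := univ.filter fun s => (s : Set ι) ∈ V with hV'
  set W' : Finset (Finset ι) := univ.filter fun s => (s : Set ι) ∈ W with hW'
  have hmV : ∀ s : Finset ι, s ∈ V' ↔ (s : Set ι) ∈ V := fun s => by
    rw [hV', mem_filter]; exact ⟨fun h => h.2, fun h => ⟨mem_univ _, h⟩⟩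
  have hmW : ∀ s : Finset ι, s ∈ W' ↔ (s : Set ι) ∈ W := fun s => by
    rw [hW', mem_filter]; exact ⟨fun h => h.2, fun h => ⟨mem_univ _, h⟩⟩
  have hV'up : IsUpperSet (V' : Set (Finset ι)) := by
    intro a b hab ha
    rw [mem_coe, hmV] at ha ⊢
    exact hV (coe_subset.2 hab) ha
  have hW'up : IsUpperSet (W' : Set (Finset ι)) := by
    intro a b hab ha
    rw [mem_coe, hmW] at ha ⊢
    exact hW (coe_subset.2 hab) ha
  have hV'0 : (∅ : Finset ι) ∉ V' := fun h => hV0 (by rw [hmV, coe_empty] at h; exact h)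
  have hW'0 : (∅ : Finset ι) ∉ W' := fun h => hW0 (by rw [hmW, coe_empty] at h; exact h)
  have hcount := ThresholdTwoFibre.thresholdTwo_counting V' W' hV'up hW'up hV'0 hW'0 hι
  have hΘ : ∀ s : Finset ι, ((s : Set ι) ∈ {T : Set ι | 2 ≤ T.ncard}) ↔ 2 ≤ #s := fun s => by
    rw [Set.mem_setOf_eq, Set.ncard_coe_finset]
  have hΘc : ∀ a b : Finset ι, (((a : Set ι) ∪ (b : Set ι))ᶜ ∈ {T : Set ι | 2 ≤ T.ncard}) ↔ 2 ≤ #(a ∪ b)ᶜ :=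
    fun a b => by rw [← coe_union, ← coe_compl, hΘ]
  have hmVc : ∀ a b : Finset ι, (((a : Set ι) ∪ (b : Set ι))ᶜ ∈ V) ↔ (a ∪ b)ᶜ ∈ V' :=
    fun a b => by rw [← coe_union, ← coe_compl, hmV]
  have hmWc : ∀ a b : Finset ι, (((a : Set ι) ∪ (b : Set ι))ᶜ ∈ W) ↔ (a ∪ b)ᶜ ∈ W' :=
    fun a b => by rw [← coe_union, ← coe_compl, hmW]
  -- `top(Θ₂ ∩ V ∩ W)`: (S₁,S₂,S₃) ↦ (u,s) = (S₃,S₁)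
  have e_top : top ({T : Set ι | 2 ≤ T.ncard} ∩ V ∩ W) =
      #((univ : Finset (Finset ι × Finset ι)).filter fun q => ((q.1 ∈ V' ∧ q.1 ∈ W') ∧ Disjoint q.1 q.2) ∧ 2 ≤ #q.1) := by
    unfold top; rw [tri_eq_card_finsetPairs]
    refine card_bij' (fun r _ => ((r.1 ∪ r.2)ᶜ, r.1)) (fun q _ => (q.2, (q.2 ∪ q.1)ᶜ)) (fun r hr => ?_) (fun q hq => ?_)
      (fun r hr => ?_) (fun q hq => ?_)
    · simp only [mem_filter, mem_univ, true_and] at hr ⊢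
      obtain ⟨hd, hm⟩ := hr
      rw [Set.mem_inter_iff, Set.mem_inter_iff, hΘc, hmVc, hmWc] at hm
      exact ⟨⟨⟨hm.1.2, hm.2⟩, disjoint_compl_union_left _ _⟩, hm.1.1⟩
    · simp only [mem_filter, mem_univ, true_and] at hq ⊢
      obtain ⟨⟨⟨hv, hw⟩, hd⟩, h2⟩ := hq
      refine ⟨(disjoint_compl_union_left _ _).symm, ?_⟩
      rw [coe_union_coe_compl_union hd.symm, Set.mem_inter_iff, Set.mem_inter_iff, hΘ, ← hmV, ← hmW]
      exact ⟨⟨h2, hv⟩, hw⟩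
    · simp only [mem_filter, mem_univ, true_and] at hr
      exact Prod.ext rfl (compl_union_compl_union hr.1)
    · simp only [mem_filter, mem_univ, true_and] at hq
      exact Prod.ext (compl_union_compl_union hq.1.2.symm) rfl
  -- `dee(Θ₂, V ∩ W)`: (S₁,S₂,S₃) ↦ (u,a) = (S₃,S₁)
  have e_deeU : dee {T : Set ι | 2 ≤ T.ncard} (V ∩ W) =
      #((univ : Finset (Finset ι × Finset ι)).filter fun q => ((q.1 ∈ V' ∧ q.1 ∈ W') ∧ Disjoint q.1 q.2) ∧ 2 ≤ #q.2) := by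
    unfold dee; rw [tri_eq_card_finsetPairs]
    refine card_bij' (fun r _ => ((r.1 ∪ r.2)ᶜ, r.1)) (fun q _ => (q.2, (q.2 ∪ q.1)ᶜ)) (fun r hr => ?_) (fun q hq => ?_)
      (fun r hr => ?_) (fun q hq => ?_)
    · simp only [mem_filter, mem_univ, true_and] at hr ⊢
      obtain ⟨hd, h1, hm⟩ := hr
      rw [Set.mem_inter_iff, hmVc, hmWc] at hm
      rw [hΘ] at h1
      exact ⟨⟨⟨hm.1, hm.2⟩, disjoint_compl_union_left _ _⟩, h1⟩
    · simp only [mem_filter, mem_univ, true_and] at hq ⊢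
      obtain ⟨⟨⟨hv, hw⟩, hd⟩, h2⟩ := hq
      refine ⟨(disjoint_compl_union_left _ _).symm, (hΘ _).2 h2, ?_⟩
      rw [coe_union_coe_compl_union hd.symm, Set.mem_inter_iff, ← hmV, ← hmW]
      exact ⟨hv, hw⟩
    · simp only [mem_filter, mem_univ, true_and] at hr
      exact Prod.ext rfl (compl_union_compl_union hr.1)
    · simp only [mem_filter, mem_univ, true_and] at hq
      exact Prod.ext (compl_union_compl_union hq.1.2.symm) rfl
  -- `dee(V, Θ₂ ∩ W)`: (S₁,S₂,S₃) ↦ (v,w) = (S₁,S₃)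
  have e_deeV : dee V ({T : Set ι | 2 ≤ T.ncard} ∩ W) =
      #((univ : Finset (Finset ι × Finset ι)).filter fun q => (q.1 ∈ V' ∧ q.2 ∈ W' ∧ Disjoint q.1 q.2) ∧ 2 ≤ #q.2) := by
    unfold dee; rw [tri_eq_card_finsetPairs]
    refine card_bij' (fun r _ => (r.1, (r.1 ∪ r.2)ᶜ)) (fun q _ => (q.1, (q.1 ∪ q.2)ᶜ)) (fun r hr => ?_) (fun q hq => ?_)
      (fun r hr => ?_) (fun q hq => ?_)
    · simp only [mem_filter, mem_univ, true_and] at hr ⊢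
      obtain ⟨hd, h1, hm⟩ := hr
      rw [Set.mem_inter_iff, hΘc, hmWc] at hm
      rw [← hmV] at h1
      exact ⟨⟨h1, hm.2, (disjoint_compl_union_left _ _).symm⟩, hm.1⟩
    · simp only [mem_filter, mem_univ, true_and] at hq ⊢
      obtain ⟨⟨hv, hw, hd⟩, h2⟩ := hq
      refine ⟨(disjoint_compl_union_left _ _).symm, (hmV _).1 hv, ?_⟩
      rw [coe_union_coe_compl_union hd, Set.mem_inter_iff, hΘ, ← hmW]
      exact ⟨h2, hw⟩
    · simp only [mem_filter, mem_univ, true_and] at hr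
      exact Prod.ext rfl (compl_union_compl_union hr.1)
    · simp only [mem_filter, mem_univ, true_and] at hq
      exact Prod.ext rfl (compl_union_compl_union hq.1.2.2)
  -- `dee(W, Θ₂ ∩ V)`: (S₁,S₂,S₃) ↦ (v,w) = (S₃,S₁)
  have e_deeW : dee W ({T : Set ι | 2 ≤ T.ncard} ∩ V) =
      #((univ : Finset (Finset ι × Finset ι)).filter fun q => (q.1 ∈ V' ∧ q.2 ∈ W' ∧ Disjoint q.1 q.2) ∧ 2 ≤ #q.1) := by
    unfold dee; rw [tri_eq_card_finsetPairs]
    refine card_bij' (fun r _ => ((r.1 ∪ r.2)ᶜ, r.1)) (fun q _ => (q.2, (q.2 ∪ q.1)ᶜ)) (fun r hr => ?_) (fun q hq => ?_)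
      (fun r hr => ?_) (fun q hq => ?_)
    · simp only [mem_filter, mem_univ, true_and] at hr ⊢
      obtain ⟨hd, h1, hm⟩ := hr
      rw [Set.mem_inter_iff, hΘc, hmVc] at hm
      rw [← hmW] at h1
      exact ⟨⟨hm.2, h1, disjoint_compl_union_left _ _⟩, hm.1⟩
    · simp only [mem_filter, mem_univ, true_and] at hq ⊢
      obtain ⟨⟨hv, hw, hd⟩, h2⟩ := hq
      refine ⟨(disjoint_compl_union_left _ _).symm, (hmW _).1 hw, ?_⟩
      rw [coe_union_coe_compl_union hd.symm, Set.mem_inter_iff, hΘ, ← hmV]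
      exact ⟨h2, hv⟩
    · simp only [mem_filter, mem_univ, true_and] at hr
      exact Prod.ext rfl (compl_union_compl_union hr.1)
    · simp only [mem_filter, mem_univ, true_and] at hq
      exact Prod.ext (compl_union_compl_union hq.1.2.2.symm) rfl
  -- `tee(Θ₂, V, W)`: (S₁,S₂,S₃) ↦ (v,w) = (S₂,S₃)
  have e_tee : tee {T : Set ι | 2 ≤ T.ncard} V W =
      #((univ : Finset (Finset ι × Finset ι)).filter fun q =>
        (q.1 ∈ V' ∧ q.2 ∈ W' ∧ Disjoint q.1 q.2) ∧ 2 ≤ #(q.1 ∪ q.2)ᶜ) := by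
    unfold tee; rw [tri_eq_card_finsetPairs]
    refine card_bij' (fun r _ => (r.2, (r.1 ∪ r.2)ᶜ)) (fun q _ => ((q.1 ∪ q.2)ᶜ, q.1)) (fun r hr => ?_) (fun q hq => ?_)
      (fun r hr => ?_) (fun q hq => ?_)
    · simp only [mem_filter, mem_univ, true_and] at hr ⊢
      obtain ⟨hd, h1, h2, h3⟩ := hr
      rw [hΘ] at h1
      rw [← hmV] at h2
      rw [hmWc] at h3
      refine ⟨⟨h2, h3, ?_⟩, ?_⟩
      · exact disjoint_left.2 fun x hx hxc => (mem_compl.1 hxc) (mem_union_right _ hx)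
      · rw [union_comm r.1 r.2, compl_union_compl_union hd.symm]; exact h1
    · simp only [mem_filter, mem_univ, true_and] at hq ⊢
      obtain ⟨⟨hv, hw, hd⟩, h2⟩ := hq
      refine ⟨disjoint_compl_union_left _ _, (hΘ _).2 h2, (hmV _).1 hv, ?_⟩
      rw [coe_compl_union_union_coe hd, ← hmW]; exact hw
    · simp only [mem_filter, mem_univ, true_and] at hr
      refine Prod.ext ?_ rfl
      show (r.2 ∪ (r.1 ∪ r.2)ᶜ)ᶜ = r.1
      rw [union_comm r.1 r.2, compl_union_compl_union hr.1.symm]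
    · simp only [mem_filter, mem_univ, true_and] at hq
      refine Prod.ext rfl ?_
      show ((q.1 ∪ q.2)ᶜ ∪ q.1)ᶜ = q.2
      exact compl_compl_union_union hq.1.2.2
  unfold threePartN
  rw [e_top, e_tee, e_deeU, e_deeV, e_deeW]
  push_cast
  omega

end Summit.CriticalPhenomena.PercolationContinuityZ3.Theorems.ThreePartition

end
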